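import Literature.NumberTheory.Automorphic.ArtinLFunctionsAbelianFrobeniusProofs
import Literature.NumberTheory.GaloisRepresentations.ArtinCharacterReciprocityProofs
import Literature.NumberTheory.GaloisRepresentations.ArtinFormalismInductionProofs
import Literature.NumberTheory.GaloisRepresentations.ArtinLFunctionProofs
import Literature.NumberTheory.GaloisRepresentations.HeckeLFunctionAnalyticProofs
import Literature.NumberTheory.LFunctions.RayClassCharacterProofs
import Literature.NumberTheory.LFunctions.DedekindZetaFunctionalEquationProofs
import Literature.NumberTheory.LFunctions.DedekindZetaNonvanishing
import HarnessLib

/-!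
# Abelian Artin L-functions are Hecke L-functions: the discharge of
`artinLFunction_abelian_eq_heckeLFunction` (and of `artinReciprocity_character_primitive`)

Topic `Literature/NumberTheory/Automorphic`; namespace `Literature.NumberTheory.Automorphic`.  Pure-proof
companion of `ArtinLFunctionsBrauer.lean` (the named fact `artinLFunction_abelian_eq_heckeLFunction`:
for every character `ψ : Γ_K → GL_1(ℂ)` of finite image there is a finite-order Hecke character `χ`
with `L(s, ψ) = L(χ, s)` on `re s > 1`; Neukirch VII (10.6) with its Remark, p. 526: "one has complete
equality `𝓛(L|K, χ, s) = L(χ̃, s)` … `χ̃` is a *primitive* Größencharakter `mod 𝔣`") and of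
`ArtinLFunctionsAbelianFrobeniusProofs.lean`, which reduced that fact to the ideal-theoretic reciprocity
law `GaloisRepresentations.artinReciprocity_rankOne K` (now a theorem of the tree,
`GaloisRepresentations.artinReciprocity_rankOne_holds`) together with ONE clause
(`artinLFunction_abelian_eq_heckeLFunction_of_rankOne`): *a Hecke character matching `ψ` at the places
where `ψ` is unramified is ramified wherever `ψ` is* — the direction "`𝔭` ramified `⟹ 𝔭 ∣ 𝔣`" of the
conductor–ramification theorem (Neukirch VI (6.6); Childress Ch. 6 Thm. 3.4/3.7), i.e. the primitivity
of `χ̃` in VII (10.6).  This file **proves that clause** (`isUnramifiedAt_of_heckeCharacter_isUnramifiedAt`)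
and concludes:

* `artinLFunction_abelian_eq_heckeLFunction_holds` — **the named fact holds**, for number fields in
  every universe;
* `artinReciprocity_character_primitive_holds` — the primitive form of Artin reciprocity for
  characters (`ArtinLFunctionsAbelianFrobenius`) holds as well
  (`artinReciprocity_character_primitive_iff_rankOne_and_ramified`).

## The proof of the clause

Neukirch proves VI (6.6) from local class field theory and the local–global compatibility of the norm
residue symbol (VI (5.6), V (1.7)); neither is in the tree.  The clause is proved here **analytically**,
from theorems the tree already has — a genuinely shorter road, recorded as a deviation from the printed
proof.  Suppose `χ(ϖ_v) = det ψ(Φ_v)` with `χ` unramified wherever `ψ` is, and that `ψ` ramifies at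
`v₀` while `χ` does not.

1. *Artin factorisation.*  With `M = K̄^{ker ψ}` and `n = |ψ(Γ_K)| > 1`,
   `ζ_M(s) = ∏_{j<n} L(s, ψ^j)` on `re s > 1` (`exists_dedekindZeta_eq_prod_artinLFunction_pow`):
   the regular representation of the cyclic group `ψ(Γ_K)`, inflated to `Γ_K`, is induced from the
   trivial character of `Γ_M` (Neukirch VII (10.4) (iv), `artinLFunction_eq_of_isInducedFrom_holds`;
   (10.4) (i), `artinLFunction_trivial_eq_dedekindZeta_holds`) and has the character `∑_{j<n} det ψ^j`
   ((10.4) (ii) and p. 522, through `HasArtinRealization` of `ArtinLFunctionsBrauerProofs`).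
2. *Continuations.*  Each `L(s, ψ^j)` extends holomorphically to `ℂ ∖ {0, 1}`
   (`exists_differentiableOn_eq_artinLFunction_rankOne`: Artin reciprocity in degree one identifies it
   with a ray-class L-series, `GaloisRepresentations.artinLFunction_eq_rayClassLSeries`, continued by
   Hecke, `LFunctions.rayClassLSeries_hasMeromorphicContinuation_holds`), and so does `L(χ, s)`
   (`exists_differentiableOn_eq_heckeLFunction`, through a module of definition supported exactly on the
   ramified places of `χ`).
3. *Missing Euler factors.*  `L(s, ψ) = L(χ, s) · ∏_{v ∈ B} (1 - χ(ϖ_v) 𝔑v^{-s})` on `re s > 1`, where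
   `B ∋ v₀` is the finite set of places at which `ψ` ramifies but `χ` does not
   (`artinLFunction_eq_heckeLFunction_mul_prod`).
4. *The contradiction.*  By the identity theorem on the connected open set `ℂ ∖ {0, 1}` both identities
   persist for the continuations.  At `s₀ = it₀`, `t₀ = (arg χ(ϖ_{v₀}) + 2π)/log 𝔑v₀ ≠ 0`, the factor
   `1 - χ(ϖ_{v₀}) 𝔑v₀^{-s₀}` vanishes (`exists_one_sub_mul_cpow_neg_eq_zero`), hence so does the
   continuation of `L(s, ψ)`, hence `ζ_M(s₀) = 0`.  But `ζ_M` has no zero at `it₀`, `t₀ ≠ 0`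
   (`dedekindZetaCont_ne_zero_of_re_eq_zero`): Hecke's functional equation
   `Λ_M(1 - s) = Λ_M(s)` (`LFunctions.completedDedekindZeta_one_sub_holds`, Neukirch VII (5.10)) and
   `ζ_M(1 - it₀) ≠ 0` (`LFunctions.dedekindZetaCont_ne_zero_of_one_le_re_holds`, Landau 1903).

No definition, no named fact, no statement change (D-0014/D-0026); the characters `ψ^j` are built
locally inside `exists_dedekindZeta_eq_prod_artinLFunction_pow`.

## References

* J. Neukirch, *Algebraic Number Theory*, Grundlehren 322, Springer 1999: Ch. VII §10 Thm. (10.6), its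
  proof and the Remark (pp. 525–526); Prop. (10.4) and p. 522; Ch. VII §5 Cor. (5.10); Ch. VII §6
  Cor. (6.14); Ch. VII §8 Thm. (8.5); Ch. VI §6 Cor. (6.6), §7 Thm. (7.1). [NeukirchANT1999]
* N. Childress, *Class Field Theory*, Universitext, Springer 2009, Ch. 6 §3, Thm. 3.4 and Thm. 3.7.
  [Childress2009]
* E. Artin, *Zur Theorie der L-Reihen mit allgemeinen Gruppencharakteren*, Abh. Math. Sem. Hamburg 8
  (1931), §1–§2. [ArtinHamburg1931]
* E. Hecke, *Über die Zetafunktion beliebiger algebraischer Zahlkörper*, Nachr. Ges. Wiss. Göttingen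
  (1917), 77–89. [Hecke1917]
* E. Landau, *Neuer Beweis des Primzahlsatzes und Beweis des Primidealsatzes*, Math. Ann. 56 (1903),
  645–670. [LandauMathAnn1903]
-/

noncomputable section

open scoped NumberField
open Field IsDedekindDomain NumberField Filter Complex
open Literature.NumberTheory.GaloisRepresentations Literature.NumberTheory.LFunctions
open Literature.RepresentationTheory.FiniteGroups

universe u

namespace Literature.NumberTheory.Automorphic

/-! ### Analytic preliminaries -/

/-- Identity theorem on `ℂ ∖ {0, 1}` from the half-plane `re s > 1`. [folklore] -/
theorem eqOn_compl_zero_one_of_eqOn_one_lt_re {f g : ℂ → ℂ}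
    (hf : DifferentiableOn ℂ f ({0, 1}ᶜ : Set ℂ)) (hg : DifferentiableOn ℂ g ({0, 1}ᶜ : Set ℂ))
    (h : ∀ s : ℂ, 1 < s.re → f s = g s) : Set.EqOn f g ({0, 1}ᶜ : Set ℂ) := by
  have hfin : ({0, 1} : Set ℂ).Finite := Set.toFinite _
  have hopen : IsOpen (({0, 1} : Set ℂ)ᶜ) := hfin.isClosed.isOpen_compl
  have hpc : IsPreconnected (({0, 1} : Set ℂ)ᶜ) :=
    (hfin.countable.isPathConnected_compl_of_one_lt_rank
      (rank_real_complex ▸ Nat.one_lt_ofNat)).isConnected.isPreconnected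
  have hne : (2 : ℂ) ∈ (({0, 1} : Set ℂ)ᶜ) := by norm_num
  refine AnalyticOnNhd.eqOn_of_preconnected_of_eventuallyEq (𝕜 := ℂ)
    (hf.analyticOnNhd hopen) (hg.analyticOnNhd hopen) hpc hne ?_
  refine eventually_of_mem ?_ (fun t (ht : 1 < t.re) => h t ht)
  exact (continuous_re.isOpen_preimage _ isOpen_Ioi).mem_nhds (by simp : 1 < (2 : ℂ).re)

/-! ### The regular character of a finite group -/

/-- `Ind_{1}^{G} 𝟙` is the regular character: `|G|` at `1`, `0` elsewhere. [folklore] -/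
theorem indClassFun_bot_const_one {G : Type} [Group G] [Fintype G] [DecidableEq G] (g : G) :
    indClassFun (⊥ : Subgroup G) (fun _ => (1 : ℂ)) g =
      if g = 1 then (Fintype.card G : ℂ) else 0 := by
  unfold indClassFun
  have hext : ∀ x : G, Function.extend (Subtype.val : (⊥ : Subgroup G) → G) (fun _ => (1 : ℂ)) 0 x =
      if x = 1 then 1 else 0 := by
    intro x
    split_ifs with hx
    · have : x = ((⟨1, (⊥ : Subgroup G).one_mem⟩ : (⊥ : Subgroup G)) : G) := hx
      rw [this, Subtype.val_injective.extend_apply]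
    · rw [Function.extend_apply']
      · rfl
      · rintro ⟨a, rfl⟩
        exact hx (Subgroup.mem_bot.mp a.2)
  have hiff : ∀ t : G, t⁻¹ * g * t = 1 ↔ g = 1 := fun t => by
    constructor
    · intro h
      have h' : t * (t⁻¹ * g * t) * t⁻¹ = t * 1 * t⁻¹ := by rw [h]
      simpa [mul_assoc] using h'
    · rintro rfl; simp
  simp only [hext, hiff, Subgroup.card_bot, Nat.cast_one, inv_one, one_mul]
  split_ifs with hg
  · simp
  · simp

/-! ### Characters of degree one: trace and continuation -/

section RankOne

variable {K : Type u} [Field K] [NumberField K]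

omit [NumberField K] in
/-- The character (trace) of the representation on `ℂ¹` underlying `ψ : Γ_K → GL_1(ℂ)` is
`γ ↦ det ψ(γ)` (a `1 × 1` matrix is its entry). [folklore] -/
theorem character_toArtinRep_rankOne (ψ : FramedArtinRep K 1) (γ : absoluteGaloisGroup K) :
    ψ.toArtinRep.toRepresentation.character γ = ((FramedRep.det ψ γ : ℂˣ) : ℂ) := by
  have h : (ψ.toArtinRep.toRepresentation γ : (Fin 1 → ℂ) →ₗ[ℂ] (Fin 1 → ℂ)) =
      Matrix.toLin' ((ψ γ : GL (Fin 1) ℂ) : Matrix (Fin 1) (Fin 1) ℂ) := by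
    refine LinearMap.ext fun v => ?_
    rw [Matrix.toLin'_apply]
    rfl
  rw [Representation.character, h, Matrix.trace_toLin'_eq, Matrix.trace_fin_one, FramedRep.det_apply,
    Matrix.GeneralLinearGroup.val_det_apply, Matrix.det_fin_one]

/-- **Every Artin L-function of degree one extends holomorphically to `ℂ ∖ {0, 1}`** (Artin
reciprocity in degree one, `artinReciprocity_rankOne_holds`, identifies it on `re s > 1` with the
L-series of a ray class character, `artinLFunction_eq_rayClassLSeries`, which Hecke's theorem
`rayClassLSeries_hasMeromorphicContinuation_holds` continues).
[cite: NeukirchANT1999, Ch. VII §10 Thm. (10.6) (Remark and following paragraph); Ch. VII §8 Thm. (8.5)] -/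
theorem exists_differentiableOn_eq_artinLFunction_rankOne (ψ : FramedArtinRep K 1) :
    ∃ F : ℂ → ℂ, DifferentiableOn ℂ F ({0, 1}ᶜ : Set ℂ) ∧
      ∀ s : ℂ, 1 < s.re → F s = artinLFunction ψ.toArtinRep s := by
  obtain ⟨𝔣, h𝔣, χ, hχ, hunr, hram⟩ := artinReciprocity_rankOne_holds K ψ
  obtain ⟨F, -, hFd, hFs⟩ := rayClassLSeries_hasMeromorphicContinuation_holds (K := K) 𝔣 h𝔣 χ hχ
  exact ⟨F, hFd, fun s hs => by rw [hFs s hs, artinLFunction_eq_rayClassLSeries ψ h𝔣 hχ hunr hram hs]⟩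

end RankOne

/-! ### The Artin factorisation `ζ_M(s) = ∏_{j < n} L(s, ψ^j)` -/

section Factorisation

variable {K : Type u} [Field K] [NumberField K]

omit [NumberField K] in
/-- `det ψ(γ) = 1 ↔ ψ(γ) = 1` in `GL_1(ℂ)`. [folklore] -/
theorem det_eq_one_iff_rankOne (ψ : FramedArtinRep K 1) (γ : absoluteGaloisGroup K) :
    FramedRep.det ψ γ = 1 ↔ ψ γ = 1 := by
  constructor
  · intro h
    exact generalLinearGroup_fin_one_eq_of_det_eq (by rw [← FramedRep.det_apply, h, map_one])
  · intro h
    rw [FramedRep.det_apply, h, map_one]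

/-- **Artin's factorisation of the Dedekind zeta function of the field cut out by a character of
degree one** (Neukirch VII (10.4) (i), (ii), (iv) with the decomposition of the regular
representation of the finite cyclic group `G = ψ(Γ_K)`: `r_G = ∑_{j < n} ψ^j`, `n = |G|`).  For a
non-trivial `ψ : Γ_K → GL_1(ℂ)` there are a number field `M` (the fixed field `K̄^{ker ψ}`) and
`n > 1` with `ζ_M(s) = ∏_{j<n} L(s, ψ^j)` for `re s > 1`.  Proof: the regular representation of `G`
inflated to `Γ_K` is induced from the trivial character of `Γ_M` (`ArtinRep.isInducedFrom_monomial`),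
so its L-function is `L(s, 𝟙_M) = ζ_M(s)` (`artinLFunction_eq_of_isInducedFrom_holds`,
`artinLFunction_trivial_eq_dedekindZeta_holds`); its character `|G| · [ψ(γ) = 1]` is
`∑_{j<n} det ψ(γ)^j` (geometric sum of the `n`-th root of unity `det ψ(γ)`), the character of
`⊕_{j<n} ψ^j`, and Artin L-functions depend only on the character and are multiplicative
(`HasArtinRealization`).
[cite: NeukirchANT1999, Ch. VII §10 Prop. (10.4) (i), (ii), (iv) and p. 522] -/
theorem exists_dedekindZeta_eq_prod_artinLFunction_pow (ψ : FramedArtinRep K 1)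
    (hψ : ∃ γ, FramedRep.det ψ γ ≠ 1) :
    ∃ Ψ : ℕ → FramedArtinRep K 1, Ψ 1 = ψ ∧
      (∀ (j : ℕ) (γ : absoluteGaloisGroup K), FramedRep.det (Ψ j) γ = FramedRep.det ψ γ ^ j) ∧
      ∃ (M : Type u) (_ : Field M) (_ : NumberField M) (n : ℕ), 1 < n ∧
        ∀ s : ℂ, 1 < s.re →
          NumberField.dedekindZeta M s =
            ∏ j ∈ Finset.range n, artinLFunction (Ψ j).toArtinRep s := by
  classical
  -- the powers `ψ^j : Γ_K → GL_1(ℂ)` (through `ℂˣ ≃ GL_1(ℂ)`)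
  let D : ℕ → (absoluteGaloisGroup K →* ℂˣ) := fun j =>
    { toFun := fun γ => FramedRep.det ψ γ ^ j
      map_one' := by rw [map_one, one_pow]
      map_mul' := fun a b => by rw [map_mul, mul_pow] }
  have hDc : ∀ j, Continuous (D j) := fun j =>
    (continuous_pow j).comp (FramedRep.det ψ).continuous_toFun
  let Ψ : ℕ → FramedArtinRep K 1 := fun j =>
    ContinuousMonoidHom.comp
      (FramedRep.unitsContinuousMulEquivOfUnique (Fin 1) ℂ : ℂˣ →ₜ* GL (Fin 1) ℂ) ⟨D j, hDc j⟩
  have hΨcoe : ∀ (j : ℕ) (γ : absoluteGaloisGroup K) (i k : Fin 1),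
      ((Ψ j γ : GL (Fin 1) ℂ) : Matrix (Fin 1) (Fin 1) ℂ) i k = ((FramedRep.det ψ γ ^ j : ℂˣ) : ℂ) :=
    fun _ _ _ _ => rfl
  have hdetΨ : ∀ (j : ℕ) (γ : absoluteGaloisGroup K), FramedRep.det (Ψ j) γ = FramedRep.det ψ γ ^ j :=
    fun j γ => Units.ext (by
      rw [FramedRep.det_apply, Matrix.GeneralLinearGroup.val_det_apply, Matrix.det_fin_one, hΨcoe])
  have hΨ1 : Ψ 1 = ψ :=
    ContinuousMonoidHom.ext fun γ => generalLinearGroup_fin_one_eq_of_det_eq (by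
      rw [← FramedRep.det_apply, ← FramedRep.det_apply, hdetΨ, pow_one])
  have hcharΨ : ∀ (j : ℕ) (γ : absoluteGaloisGroup K),
      (Ψ j).toArtinRep.toRepresentation.character γ = ((FramedRep.det ψ γ : ℂˣ) : ℂ) ^ j := fun j γ => by
    rw [character_toArtinRep_rankOne, hdetΨ, Units.val_pow_eq_pow_val]
  refine ⟨Ψ, hΨ1, hdetΨ, ?_⟩
  -- the scalar character `d = det ψ : Γ_K → ℂˣ`, its finite image `G` and `q : Γ_K ↠ G`
  set d : absoluteGaloisGroup K →* ℂˣ := (FramedRep.det ψ).toMonoidHom with hd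
  have hdapp : ∀ γ, d γ = FramedRep.det ψ γ := fun γ => rfl
  have hker : d.ker = ψ.toMonoidHom.ker := by
    ext γ
    rw [MonoidHom.mem_ker, MonoidHom.mem_ker, hdapp, det_eq_one_iff_rankOne]
    rfl
  have hopen : IsOpen (d.ker : Set (absoluteGaloisGroup K)) := by
    rw [hker]; exact ψ.isOpen_ker_toMonoidHom
  haveI : Finite (absoluteGaloisGroup K ⧸ d.ker) := Subgroup.quotient_finite_of_isOpen _ hopen
  haveI : Finite d.range := Finite.of_equiv _ (QuotientGroup.quotientKerEquivRange d).toEquiv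
  letI : Fintype d.range := Fintype.ofFinite _
  set q : absoluteGaloisGroup K →* d.range := d.rangeRestrict with hq_def
  have hq : IsArtinQuotient q :=
    ⟨MonoidHom.rangeRestrict_surjective d, by rw [hq_def, MonoidHom.ker_rangeRestrict]; exact hopen⟩
  have hqval : ∀ γ, ((q γ : d.range) : ℂˣ) = FramedRep.det ψ γ := fun γ => rfl
  set n : ℕ := Fintype.card d.range with hn
  have h1n : 1 < n := by
    obtain ⟨γ₀, hγ₀⟩ := hψ
    rw [hn, Fintype.one_lt_card_iff_nontrivial]
    refine ⟨⟨1, q γ₀, fun h => hγ₀ ?_⟩⟩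
    have := congrArg (fun x : d.range => (x : ℂˣ)) h
    simp only [OneMemClass.coe_one, hqval] at this
    exact this.symm
  -- the field `M = K̄^{ker ψ}` cut out by `ψ`
  set M := quotientFixedField q (⊥ : Subgroup d.range) with hM
  haveI : FiniteDimensional K M := finiteDimensional_quotientFixedField hq ⊥
  haveI : NumberField M := NumberField.of_module_finite K M
  refine ⟨M, inferInstance, inferInstance, n, h1n, fun s hs => ?_⟩
  -- the regular representation of `G` on `Γ_K` is induced from the trivial character of `Γ_M`
  set σ := ArtinRep.monomial hq (⊥ : Subgroup d.range) 1 with hσ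
  have hind := ArtinRep.isInducedFrom_monomial hq (⊥ : Subgroup d.range) 1
  have h4 : artinLFunction σ s = artinLFunction (hq.cutCharacter ⊥ 1).toArtinRep s :=
    artinLFunction_eq_of_isInducedFrom_holds (K := K) (M := M) σ _ hind s hs
  -- the cut-out character is trivial, so its L-function is `ζ_M`
  have hcut1 : ∀ δ : absoluteGaloisGroup M, hq.cutCharacter ⊥ 1 δ = 1 := fun δ => by
    refine generalLinearGroup_fin_one_eq_of_det_eq (Units.ext ?_)
    rw [Matrix.GeneralLinearGroup.val_det_apply, Matrix.det_fin_one,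
      IsArtinQuotient.cutCharacter_apply_coe, IsArtinQuotient.cutHom_apply, MonoidHom.one_apply,
      map_one]
  have hchar : ∀ δ : absoluteGaloisGroup M,
      (hq.cutCharacter ⊥ 1).toArtinRep.toRepresentation.character δ =
        (ContinuousRep.trivial (absoluteGaloisGroup M) ℂ ℂ).toRepresentation.character δ := by
    intro δ
    rw [character_toArtinRep_rankOne, FramedRep.det_apply, hcut1, map_one, Units.val_one]
    have : ((ContinuousRep.trivial (absoluteGaloisGroup M) ℂ ℂ).toRepresentation δ : ℂ →ₗ[ℂ] ℂ) = 1 :=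
      LinearMap.ext fun v => rfl
    rw [Representation.character, this, LinearMap.trace_one, Module.finrank_self, Nat.cast_one]
  have hζ : artinLFunction (hq.cutCharacter ⊥ 1).toArtinRep s = NumberField.dedekindZeta M s := by
    rw [artinLFunction_eq_of_character_eq_holds _ _ hchar]
    exact artinLFunction_trivial_eq_dedekindZeta_holds (K := M) hs
  -- realisations: the regular character, and the sum of the powers of `ψ`
  have hLHS : HasArtinRealization (K := K)
      (fun γ => indClassFun (⊥ : Subgroup d.range)
        (fun h => (((1 : (⊥ : Subgroup d.range) →* ℂˣ) h : ℂˣ) : ℂ)) (q γ))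
      (artinLFunction σ) :=
    ⟨d.range ⧸ (⊥ : Subgroup d.range) → ℂ, _, _, inferInstance, _, inferInstance, σ,
      fun γ => ArtinRep.character_monomial hq ⊥ 1 γ, fun _ _ => rfl⟩
  have hRj : ∀ j : ℕ, HasArtinRealization (K := K) (fun γ => ((FramedRep.det ψ γ : ℂˣ) : ℂ) ^ j)
      (artinLFunction (Ψ j).toArtinRep) := fun j => by
    have h := HasArtinRealization.of_artinRep (K := K) (Ψ j).toArtinRep
    have hf : (fun γ => (Ψ j).toArtinRep.toRepresentation.character γ) =
        fun γ => ((FramedRep.det ψ γ : ℂˣ) : ℂ) ^ j := funext fun γ => hcharΨ j γ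
    rwa [hf] at h
  have hRHS : HasArtinRealization (K := K)
      (∑ j ∈ Finset.range n, fun γ => ((FramedRep.det ψ γ : ℂˣ) : ℂ) ^ j)
      (∏ j ∈ Finset.range n, artinLFunction (Ψ j).toArtinRep) := by
    have := HasArtinRealization.sum (K := K) (Finset.range n) (fun _ => 1) (fun j _ => hRj j)
    simpa only [one_nsmul, pow_one] using this
  -- the two class functions agree: `∑_{j<n} det ψ(γ)^j = n · [det ψ(γ) = 1]`
  have hfeq : (fun γ => indClassFun (⊥ : Subgroup d.range)
        (fun h => (((1 : (⊥ : Subgroup d.range) →* ℂˣ) h : ℂˣ) : ℂ)) (q γ)) =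
      ∑ j ∈ Finset.range n, fun γ => ((FramedRep.det ψ γ : ℂˣ) : ℂ) ^ j := by
    funext γ
    simp only [MonoidHom.one_apply, Units.val_one, Finset.sum_apply]
    rw [indClassFun_bot_const_one]
    by_cases h1 : FramedRep.det ψ γ = 1
    · have hq1 : q γ = 1 := Subtype.ext (by rw [hqval, h1]; rfl)
      rw [if_pos hq1, h1, Units.val_one]
      simp [hn]
    · have hq1 : q γ ≠ 1 := fun h => h1 (by rw [← hqval, h]; rfl)
      rw [if_neg hq1]
      have hx1 : ((FramedRep.det ψ γ : ℂˣ) : ℂ) ≠ 1 := fun h => h1 (Units.ext h)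
      have hxn : ((FramedRep.det ψ γ : ℂˣ) : ℂ) ^ n = 1 := by
        have h0 := pow_card_eq_one (G := d.range) (x := q γ)
        have := congrArg (fun x : d.range => ((x : ℂˣ) : ℂ)) h0
        simpa only [SubmonoidClass.coe_pow, Units.val_pow_eq_pow_val, hqval, OneMemClass.coe_one,
          Units.val_one] using this
      rw [geom_sum_eq hx1, hxn, sub_self, zero_div]
  rw [hfeq] at hLHS
  have hEq := HasArtinRealization.apply_eq hLHS hRHS hs
  rw [Finset.prod_apply] at hEq
  rw [← hζ, ← h4, hEq]

end Factorisation

/-! ### `ζ_M` has no zeros on `re s = 0` off `s = 0` -/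

/-- **The Dedekind zeta function does not vanish on the line `re s = 0`, except possibly at `s = 0`**:
by Hecke's functional equation `Λ_M(1 - s) = Λ_M(s)` (`completedDedekindZeta_one_sub_holds`) a zero
at `s = it`, `t ≠ 0`, would give `Λ_M(1 - it) = 0`, but `ζ_M(1 - it) ≠ 0` (Landau; Hadamard–de la
Vallée Poussin, `dedekindZetaCont_ne_zero_of_one_le_re_holds`) and the Gamma factor has no zero at
`1 - it`.  [cite: NeukirchANT1999, Ch. VII (5.10) Corollary] [cite: LandauMathAnn1903, Part II Einleitung p. 666 property 2] -/
theorem dedekindZetaCont_ne_zero_of_re_eq_zero (M : Type*) [Field M] [NumberField M] {s : ℂ}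
    (hre : s.re = 0) (him : s.im ≠ 0) : dedekindZetaCont M s ≠ 0 := by
  intro h0
  have hsZ : ∀ n : ℤ, s ≠ n := fun n hn => him (by rw [hn]; simp)
  have hFE := completedDedekindZeta_one_sub_holds (K := M) hsZ
  have hR : completedDedekindZeta M s = 0 := by rw [completedDedekindZeta, h0, mul_zero]
  have h1s : (1 - s).re = 1 := by simp [hre]
  have hpos : 0 < (1 - s).re := by rw [h1s]; exact one_pos
  have hζ : dedekindZetaCont M (1 - s) ≠ 0 :=
    dedekindZetaCont_ne_zero_of_one_le_re_holds (K := M) (by rw [h1s]) fun h =>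
      him (by have := congrArg Complex.im h; simpa using this)
  have hΓ : dedekindGammaFactor M (1 - s) ≠ 0 := by
    unfold dedekindGammaFactor
    refine mul_ne_zero (mul_ne_zero ?_ (pow_ne_zero _ (Gammaℝ_ne_zero_of_re_pos hpos)))
      (pow_ne_zero _ ?_)
    · rw [Ne, cpow_eq_zero_iff, not_and_or]
      exact Or.inl (Nat.cast_ne_zero.mpr (Int.natAbs_ne_zero.mpr (NumberField.discr_ne_zero M)))
    · rw [Gammaℂ_def]
      refine mul_ne_zero (mul_ne_zero two_ne_zero ?_) (Gamma_ne_zero_of_re_pos hpos)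
      rw [Ne, cpow_eq_zero_iff, not_and_or]
      exact Or.inl (mul_ne_zero two_ne_zero (ofReal_ne_zero.mpr Real.pi_ne_zero))
  exact mul_ne_zero hΓ hζ (hFE.trans hR)

/-! ### The missing Euler factors -/

section EulerComparison

variable {K : Type u} [Field K] [NumberField K]

/-- **Euler-product bookkeeping.**  If the Hecke character `χ` is unramified with the Frobenius
values `χ(ϖ_v) = det ψ(Φ_v)` wherever `ψ : Γ_K → GL_1(ℂ)` is unramified, then for `re s > 1`
`L(s, ψ) = L(χ, s) · ∏_{v ∈ B} (1 - χ(ϖ_v) 𝔑v^{-s})`, where `B` is the finite set of places at which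
`ψ` ramifies but `χ` does not: the two Euler products agree at the places where `ψ` is unramified
(`FramedArtinRep.eval_eulerFactorAt_of_isUnramifiedAt`), the factor of `ψ` is `1` at its ramified
places (`FramedArtinRep.eulerFactorAt_eq_one_of_not_isUnramifiedAt`), and `L(χ, s)` carries the
extra factors `(1 - χ(ϖ_v) 𝔑v^{-s})⁻¹`, `v ∈ B`.
[cite: NeukirchANT1999, Ch. VII §10 Thm. (10.6) (proof) and §8 remark before (8.5)] -/
theorem artinLFunction_eq_heckeLFunction_mul_prod (ψ : FramedArtinRep K 1) (χ : HeckeCharacter K)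
    (hunit : χ.IsUnitary)
    (hχ : ∀ v : HeightOneSpectrum (𝓞 K), ψ.IsUnramifiedAt v →
      χ.IsUnramifiedAt v ∧ ∀ 𝔓 ∈ v.primesAbove, ∀ Φ : absoluteGaloisGroup K,
        IsArithFrobAt (𝓞 K) Φ 𝔓 → χ.valueAtUniformizer v = ((FramedRep.det ψ Φ : ℂˣ) : ℂ))
    (B : Finset (HeightOneSpectrum (𝓞 K)))
    (hB : ∀ v, v ∈ B ↔ ¬ ψ.IsUnramifiedAt v ∧ χ.IsUnramifiedAt v) {s : ℂ} (hs : 1 < s.re) :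
    artinLFunction ψ.toArtinRep s =
      heckeLFunction χ s *
        ∏ v ∈ B, (1 - χ.valueAtUniformizer v * ((v.residueCard : ℂ) ^ (-s))) := by
  classical
  -- the Euler factor data of `χ` at all places, and the correction supported on `B`
  set E : HeightOneSpectrum (𝓞 K) → ℂ := fun v =>
    (1 - χ.valueAtUniformizer v * ((v.residueCard : ℂ) ^ (-s)))⁻¹ with hE
  set f : HeightOneSpectrum (𝓞 K) → ℂ := fun v => if χ.IsUnramifiedAt v then E v else 1 with hf
  set h : HeightOneSpectrum (𝓞 K) → ℂ := fun v =>
    if v ∈ B then (1 - χ.valueAtUniformizer v * ((v.residueCard : ℂ) ^ (-s))) else 1 with hh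
  have hne : ∀ v : HeightOneSpectrum (𝓞 K),
      1 - χ.valueAtUniformizer v * ((v.residueCard : ℂ) ^ (-s)) ≠ 0 := fun v =>
    one_sub_valueAtUniformizer_mul_cpow_ne_zero hunit v (by linarith)
  -- the Euler factors of `ψ`, place by place
  have key : ∀ v, ((ψ.toArtinRep.eulerFactorAt v).eval ((v.residueCard : ℂ) ^ (-s)))⁻¹ = f v * h v := by
    intro v
    by_cases hψv : ψ.IsUnramifiedAt v
    · have hχv := (hχ v hψv).1
      have hvB : v ∉ B := fun hv => ((hB v).mp hv).1 hψv
      have hur : GaloisRep.IsUnramifiedAt v ψ.toArtinRep :=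
        (FramedGaloisRep.isUnramifiedAt_toGaloisRep_iff v ψ).mpr hψv
      obtain ⟨𝔓, h𝔓⟩ := v.primesAbove_nonempty
      obtain ⟨σ, hσ⟩ := HeightOneSpectrum.exists_isArithFrobAt_of_mem_primesAbove_holds h𝔓
      rw [FramedArtinRep.eval_eulerFactorAt_of_isUnramifiedAt ψ hur h𝔓 hσ,
        ← (hχ v hψv).2 𝔓 h𝔓 σ hσ, hf, hh, hE]
      simp only [if_pos hχv, if_neg hvB, mul_one]
    · have hur : ¬ GaloisRep.IsUnramifiedAt v ψ.toArtinRep := fun h' =>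
        hψv ((FramedGaloisRep.isUnramifiedAt_toGaloisRep_iff v ψ).mp h')
      rw [FramedArtinRep.eulerFactorAt_eq_one_of_not_isUnramifiedAt ψ hur, Polynomial.eval_one,
        inv_one, hf, hh, hE]
      by_cases hχv : χ.IsUnramifiedAt v
      · have hvB : v ∈ B := (hB v).mpr ⟨hψv, hχv⟩
        simp only [if_pos hχv, if_pos hvB, inv_mul_cancel₀ (hne v)]
      · have hvB : v ∉ B := fun hv => hχv ((hB v).mp hv).2
        simp only [if_neg hχv, if_neg hvB, mul_one]
  -- multipliability of `f` (Hecke) and `h` (finite support)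
  have hfS : f = ({v | χ.IsUnramifiedAt v} : Set (HeightOneSpectrum (𝓞 K))).mulIndicator E := by
    funext v
    rw [hf, Set.mulIndicator_apply]
    rfl
  have hfm : Multipliable f := by
    rw [hfS]
    exact (multipliable_subtype_iff_mulIndicator (f := E)
      (s := ({v | χ.IsUnramifiedAt v} : Set (HeightOneSpectrum (𝓞 K))))).mp
        (multipliable_heckeLFunction_holds χ hunit hs)
  have hhm : Multipliable h :=
    multipliable_of_ne_finset_one (s := B) fun v hv => by rw [hh]; exact if_neg hv
  -- assemble
  have hH : heckeLFunction χ s = ∏' v, f v := by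
    rw [hfS, ← tprod_subtype]
    rfl
  have hP : ∏' v, h v = ∏ v ∈ B, (1 - χ.valueAtUniformizer v * ((v.residueCard : ℂ) ^ (-s))) := by
    rw [tprod_eq_prod (s := B) (fun v hv => by rw [hh]; exact if_neg hv)]
    exact Finset.prod_congr rfl fun v hv => by rw [hh]; exact if_pos hv
  rw [artinLFunction, tprod_congr key, hfm.tprod_mul hhm, hH, hP]

/-- **The Hecke L-function of a finite-order character extends holomorphically to `ℂ ∖ {0, 1}`**:
`L(χ, s)` is the L-series of the ray class character `𝔭 ↦ χ(ϖ_𝔭)` modulo a module of definition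
supported exactly on the ramified places of `χ` (`HeckeCharacter.exists_isModulus_iff_not_isUnramifiedAt`,
`HeckeCharacter.isRayClassCharacter_of_isModulus`, Neukirch VII (6.14)), continued by Hecke's theorem
(`rayClassLSeries_hasMeromorphicContinuation_holds`, VII (8.5)).
[cite: NeukirchANT1999, Ch. VII §6 Cor. (6.14); Ch. VII §8 Thm. (8.5)] -/
theorem exists_differentiableOn_eq_heckeLFunction {χ : HeckeCharacter K} (hfin : χ.IsFiniteOrder) :
    ∃ G : ℂ → ℂ, DifferentiableOn ℂ G ({0, 1}ᶜ : Set ℂ) ∧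
      ∀ s : ℂ, 1 < s.re → G s = heckeLFunction χ s := by
  classical
  obtain ⟨R, e, hmod, hR⟩ := HeckeCharacter.exists_isModulus_iff_not_isUnramifiedAt hfin
  have h𝔣 := HeckeCharacter.modulusIdeal_ne_bot R e
  have hrc := HeckeCharacter.isRayClassCharacter_of_isModulus hfin hmod
  obtain ⟨G, -, hGd, hGs⟩ := rayClassLSeries_hasMeromorphicContinuation_holds (K := K) _ h𝔣 _ hrc
  refine ⟨G, hGd, fun s hs => ?_⟩
  rw [hGs s hs, rayClassLSeries_eq_tprod h𝔣 (fun v hv => (hrc.norm_eq_one v hv).le) hs, heckeLFunction]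
  have hset : ({v : HeightOneSpectrum (𝓞 K) | ¬ HeckeCharacter.modulusIdeal R e ≤ v.asIdeal} : Set _) =
      {v | χ.IsUnramifiedAt v} := by
    ext v
    simp only [Set.mem_setOf_eq, HeckeCharacter.modulusIdeal_le_iff, hR, not_not]
  exact tprod_congr_set_coe
    (fun v : HeightOneSpectrum (𝓞 K) => (1 - χ.valueAtUniformizer v * ((v.residueCard : ℂ) ^ (-s)))⁻¹) hset

end EulerComparison

/-- **A zero of a missing Euler factor on the imaginary axis.**  For `c` of absolute value `1` and an
integer `N > 1` there is `s₀ = it₀` with `t₀ ≠ 0` and `1 - c · N^{-s₀} = 0`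
(`t₀ = (arg c + 2π)/log N`). [folklore] -/
theorem exists_one_sub_mul_cpow_neg_eq_zero {c : ℂ} (hc : ‖c‖ = 1) {N : ℕ} (hN : 1 < N) :
    ∃ s₀ : ℂ, s₀.re = 0 ∧ s₀.im ≠ 0 ∧ 1 - c * ((N : ℂ) ^ (-s₀)) = 0 := by
  have hlog : 0 < Real.log N := Real.log_pos (by exact_mod_cast hN)
  set t₀ : ℝ := (Complex.arg c + 2 * Real.pi) / Real.log N with ht₀
  have ht₀pos : 0 < t₀ := div_pos (by linarith [Complex.neg_pi_lt_arg c, Real.pi_pos]) hlog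
  refine ⟨t₀ * I, by simp, by simp [ht₀pos.ne'], ?_⟩
  have hNc : (N : ℂ) ≠ 0 := Nat.cast_ne_zero.mpr (by omega)
  have hmul : Real.log N * t₀ = Complex.arg c + 2 * Real.pi := by
    rw [ht₀, mul_div_cancel₀ _ hlog.ne']
  have h1 : Complex.log (N : ℂ) * (-(↑t₀ * I)) = -(↑(Complex.arg c) * I) - 2 * ↑Real.pi * I := by
    rw [← natCast_log, show (↑(Real.log ↑N) : ℂ) * (-(↑t₀ * I)) = -(↑(Real.log ↑N * t₀) * I) by
      push_cast; ring, hmul]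
    push_cast
    ring
  have hcpow : (N : ℂ) ^ (-(↑t₀ * I)) = exp (-(↑(Complex.arg c) * I)) := by
    rw [cpow_def_of_ne_zero hNc, h1, exp_sub, exp_two_pi_mul_I, div_one]
  have hc' : exp (↑(Complex.arg c) * I) = c := by
    have := norm_mul_exp_arg_mul_I c
    rw [hc] at this
    simpa using this
  have h2 : c * exp (-(↑(Complex.arg c) * I)) = 1 :=
    calc c * exp (-(↑(Complex.arg c) * I))
          = exp (↑(Complex.arg c) * I) * exp (-(↑(Complex.arg c) * I)) := by rw [hc']
      _ = 1 := by rw [← exp_add, add_neg_cancel, exp_zero]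
  rw [hcpow, h2, sub_self]

/-! ### The conductor–ramification theorem and the discharge -/

section Main

variable {K : Type u} [Field K] [NumberField K]

/-- **A Hecke character matching a Galois character of degree one at its unramified places is
ramified wherever the Galois character is** — the direction "`𝔭` ramified `⟹ 𝔭 ∣ 𝔣`" of the
conductor–ramification theorem (Neukirch VI (6.6); Childress Ch. 6 Thm. 3.4, 3.7), equivalently the
*primitivity* clause of Neukirch VII (10.6), Remark ("`χ̃` is a primitive Größencharakter `mod 𝔣`").
If `χ(ϖ_v) = det ψ(Φ_v)` with `χ` unramified wherever `ψ : Γ_K → GL_1(ℂ)` is unramified, then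
`χ` unramified at `v` forces `ψ` unramified at `v`.

Proof (analytic; it deviates from Neukirch's class-field-theoretic argument via local class field
theory, VI (5.6)–(6.6), replacing it by theorems already in the tree).  Suppose `ψ` ramifies at
`v₀` while `χ` does not.  Let `M = K̄^{ker ψ}` and `n = |ψ(Γ_K)| > 1`; then
`ζ_M(s) = ∏_{j<n} L(s, ψ^j)` (`exists_dedekindZeta_eq_prod_artinLFunction_pow`, Neukirch VII
(10.4)), every `L(s, ψ^j)` extends holomorphically to `ℂ ∖ {0, 1}` (Artin reciprocity in degree one
and Hecke, `exists_differentiableOn_eq_artinLFunction_rankOne`), and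
`L(s, ψ) = L(χ, s) · ∏_{v ∈ B} (1 - χ(ϖ_v) 𝔑v^{-s})` with `v₀ ∈ B`
(`artinLFunction_eq_heckeLFunction_mul_prod`), where `L(χ, s)` also extends holomorphically to
`ℂ ∖ {0, 1}` (`exists_differentiableOn_eq_heckeLFunction`).  By the identity theorem both identities
persist on `ℂ ∖ {0, 1}`.  At `s₀ = it₀`, `t₀ = (arg χ(ϖ_{v₀}) + 2π)/log 𝔑v₀ ≠ 0`, the factor
`1 - χ(ϖ_{v₀}) 𝔑v₀^{-s₀}` vanishes (`exists_one_sub_mul_cpow_neg_eq_zero`), hence so does the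
continuation of `L(s, ψ)` and therefore `ζ_M(s₀) = 0` — contradicting the functional equation of
`ζ_M` and its non-vanishing on `re s = 1` (`dedekindZetaCont_ne_zero_of_re_eq_zero`).
[cite: NeukirchANT1999, Ch. VII §10 Thm. (10.6) (proof and Remark, pp. 525–526); Ch. VI §6 Cor. (6.6)]
[cite: Childress2009, Ch. 6 §3 Thm. 3.4 and Thm. 3.7 (PDF pp. 153–154)] -/
theorem isUnramifiedAt_of_heckeCharacter_isUnramifiedAt (ψ : FramedArtinRep K 1) (χ : HeckeCharacter K)
    (hχ : ∀ v : HeightOneSpectrum (𝓞 K), ψ.IsUnramifiedAt v →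
      χ.IsUnramifiedAt v ∧ ∀ 𝔓 ∈ v.primesAbove, ∀ Φ : absoluteGaloisGroup K,
        IsArithFrobAt (𝓞 K) Φ 𝔓 → χ.valueAtUniformizer v = ((FramedRep.det ψ Φ : ℂˣ) : ℂ))
    (v₀ : HeightOneSpectrum (𝓞 K)) (hv₀ : χ.IsUnramifiedAt v₀) : ψ.IsUnramifiedAt v₀ := by
  classical
  by_contra hψv₀
  -- (0) `χ` has finite order, hence is unitary
  have hfin : χ.IsFiniteOrder :=
    HeckeCharacter.isFiniteOrder_of_valueAtUniformizer_eq_det ψ fun v hv => (hχ v hv).2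
  have hunit : χ.IsUnitary := hfin.isUnitary
  -- (1) `ψ` is non-trivial
  have hψnt : ∃ γ, FramedRep.det ψ γ ≠ 1 := by
    by_contra hall
    push Not at hall
    exact hψv₀ fun 𝔓 _ σ _ => (det_eq_one_iff_rankOne ψ σ).mp (hall σ)
  -- (2) the exceptional set `B` and the Euler-product comparison
  have hBfin : {v : HeightOneSpectrum (𝓞 K) | ¬ ψ.IsUnramifiedAt v}.Finite :=
    Filter.eventually_cofinite.mp ψ.eventually_isUnramifiedAt
  set B : Finset (HeightOneSpectrum (𝓞 K)) := hBfin.toFinset.filter fun v => χ.IsUnramifiedAt v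
    with hBdef
  have hB : ∀ v, v ∈ B ↔ ¬ ψ.IsUnramifiedAt v ∧ χ.IsUnramifiedAt v := fun v => by
    rw [hBdef, Finset.mem_filter, Set.Finite.mem_toFinset, Set.mem_setOf_eq]
  have hv₀B : v₀ ∈ B := (hB v₀).mpr ⟨hψv₀, hv₀⟩
  set P : ℂ → ℂ := fun s =>
    ∏ v ∈ B, (1 - χ.valueAtUniformizer v * ((v.residueCard : ℂ) ^ (-s))) with hPdef
  have hAP : ∀ s : ℂ, 1 < s.re → artinLFunction ψ.toArtinRep s = heckeLFunction χ s * P s :=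
    fun s hs => artinLFunction_eq_heckeLFunction_mul_prod ψ χ hunit hχ B hB hs
  have hPd : Differentiable ℂ P := by
    have hq : ∀ v : HeightOneSpectrum (𝓞 K), (v.residueCard : ℂ) ≠ 0 := fun v =>
      Nat.cast_ne_zero.mpr (by have := v.one_lt_residueCard; omega)
    refine Differentiable.fun_finsetProd fun v _ => ?_
    exact (differentiable_const _).fun_sub ((differentiable_const _).fun_mul
      (differentiable_id.fun_neg.const_cpow (Or.inl (hq v))))
  -- (3) continuations: `G` of `L(χ, s)`, `F j` of `L(s, ψ^j)`, and `ζ_M = ∏ F j`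
  obtain ⟨G, hGd, hGs⟩ := exists_differentiableOn_eq_heckeLFunction hfin
  obtain ⟨Ψ, hΨ1, -, M, _, _, n, h1n, hζ⟩ := exists_dedekindZeta_eq_prod_artinLFunction_pow ψ hψnt
  have hF := fun j : ℕ => exists_differentiableOn_eq_artinLFunction_rankOne (Ψ j)
  choose F hFd hFs using hF
  -- (4) the identity theorem, twice
  have hU : ({0, 1}ᶜ : Set ℂ) ⊆ ({1}ᶜ : Set ℂ) :=
    Set.compl_subset_compl.mpr (Set.subset_insert _ _)
  have hζd : DifferentiableOn ℂ (dedekindZetaCont M) ({0, 1}ᶜ : Set ℂ) :=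
    (NumberField.isDedekindZetaContinuation_dedekindZetaCont_holds M).differentiableOn.mono hU
  have hprod : Set.EqOn (dedekindZetaCont M) (fun s => ∏ j ∈ Finset.range n, F j s)
      ({0, 1}ᶜ : Set ℂ) := by
    refine eqOn_compl_zero_one_of_eqOn_one_lt_re hζd
      (DifferentiableOn.fun_finsetProd fun j _ => hFd j) fun s hs => ?_
    rw [(NumberField.isDedekindZetaContinuation_dedekindZetaCont_holds M).eqOn hs, hζ s hs]
    exact Finset.prod_congr rfl fun j _ => (hFs j s hs).symm
  have hone : Set.EqOn (F 1) (G * P) ({0, 1}ᶜ : Set ℂ) := by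
    refine eqOn_compl_zero_one_of_eqOn_one_lt_re (hFd 1) (hGd.mul hPd.differentiableOn)
      fun s hs => ?_
    rw [hFs 1 s hs, hΨ1, hAP s hs, Pi.mul_apply, hGs s hs]
  -- (5) the point `s₀ = it₀` where the missing Euler factor at `v₀` vanishes
  obtain ⟨s₀, hre, him, hv₀0⟩ := exists_one_sub_mul_cpow_neg_eq_zero
    (HeckeCharacter.norm_valueAtUniformizer_of_isUnitary hunit v₀) v₀.one_lt_residueCard
  have hs₀U : s₀ ∈ ({0, 1}ᶜ : Set ℂ) := by
    simp only [Set.mem_compl_iff, Set.mem_insert_iff, Set.mem_singleton_iff, not_or]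
    exact ⟨fun h => him (by rw [h]; simp), fun h => him (by rw [h]; simp)⟩
  have hP0 : P s₀ = 0 := Finset.prod_eq_zero hv₀B hv₀0
  -- (6) `ζ_M(s₀) = 0`
  have hζ0 : dedekindZetaCont M s₀ = 0 := by
    rw [hprod hs₀U]
    show ∏ j ∈ Finset.range n, F j s₀ = 0
    refine Finset.prod_eq_zero (Finset.mem_range.mpr h1n) ?_
    rw [hone hs₀U, Pi.mul_apply, hP0, mul_zero]
  -- (7) contradiction with the functional equation of `ζ_M`
  exact dedekindZetaCont_ne_zero_of_re_eq_zero M hre him hζ0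

/-- **The conductor–ramification clause** in the form consumed by
`artinLFunction_abelian_eq_heckeLFunction_of_rankOne` and
`artinReciprocity_character_primitive_iff_rankOne_and_ramified` (Neukirch VI (6.6): "`𝔭` is ramified in
`L ⟺ 𝔭 ∣ 𝔣`", direction `⟹`, for the field cut out by `ψ` and the Hecke character of `ψ`).
[cite: NeukirchANT1999, Ch. VI §6 Cor. (6.6); Ch. VII §10 Thm. (10.6) (Remark)] -/
theorem heckeCharacter_isUnramifiedAt_imp_isUnramifiedAt :
    ∀ (ψ : FramedArtinRep K 1) (χ : HeckeCharacter K),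
      (∀ v : HeightOneSpectrum (𝓞 K), ψ.IsUnramifiedAt v →
        χ.IsUnramifiedAt v ∧ ∀ 𝔓 ∈ v.primesAbove, ∀ Φ : absoluteGaloisGroup K,
          IsArithFrobAt (𝓞 K) Φ 𝔓 → χ.valueAtUniformizer v = ((FramedRep.det ψ Φ : ℂˣ) : ℂ)) →
      ∀ v : HeightOneSpectrum (𝓞 K), χ.IsUnramifiedAt v → ψ.IsUnramifiedAt v :=
  fun ψ χ hχ v hv => isUnramifiedAt_of_heckeCharacter_isUnramifiedAt ψ χ hχ v hv

/-- **Artin reciprocity for characters of degree one, primitive form, holds**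
(`artinReciprocity_character_primitive`, Neukirch VII (10.6) Remark with VI (6.6), (7.1)):
`artinReciprocity_character_primitive_iff_rankOne_and_ramified` with the ideal-theoretic law
`artinReciprocity_rankOne_holds` and the conductor–ramification clause
`heckeCharacter_isUnramifiedAt_imp_isUnramifiedAt`.
[cite: NeukirchANT1999, Ch. VII §10 Thm. (10.6) (proof and Remark, pp. 525–526); Ch. VI Cor. (6.6), Thm. (7.1)] -/
theorem artinReciprocity_character_primitive_holds : artinReciprocity_character_primitive (K := K) :=
  artinReciprocity_character_primitive_iff_rankOne_and_ramified.mpr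
    ⟨artinReciprocity_rankOne_holds K, heckeCharacter_isUnramifiedAt_imp_isUnramifiedAt⟩

/-- **Abelian Artin L-functions are Hecke L-functions: the named fact
`artinLFunction_abelian_eq_heckeLFunction` holds** (Neukirch, *Algebraic Number Theory*, VII (10.6)
with its Remark, p. 526: for a character of degree one, "one has complete equality
`𝓛(L|K, χ, s) = L(χ̃, s)` … `χ̃` is a primitive Größencharakter `mod 𝔣`").  For every number field
`K` and every `ψ : Γ_K → GL_1(ℂ)` there is a finite-order Hecke character `χ` of `K` with
`L(s, ψ) = L(χ, s)` on `re s > 1`: `artinLFunction_abelian_eq_heckeLFunction_of_rankOne` fed with the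
ideal-theoretic reciprocity law `artinReciprocity_rankOne_holds` (global class field theory via the
global cyclic norm index inequality, Childress Thm. 5.12) and the conductor–ramification clause
`heckeCharacter_isUnramifiedAt_imp_isUnramifiedAt` (proved analytically above).
[cite: NeukirchANT1999, Ch. VII §10 Thm. (10.6) (proof and Remark, pp. 525–526); Ch. VI §6 Cor. (6.6); Ch. VI §7 Thm. (7.1)]
[cite: ArtinHamburg1931, §1] -/
theorem artinLFunction_abelian_eq_heckeLFunction_holds : artinLFunction_abelian_eq_heckeLFunction (K := K) :=
  artinLFunction_abelian_eq_heckeLFunction_of_rankOne (artinReciprocity_rankOne_holds K)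
    heckeCharacter_isUnramifiedAt_imp_isUnramifiedAt

end Main

end Literature.NumberTheory.Automorphic
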